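import Summits.Langlands.Langlands.Theses.EisensteinGelfandKirillov

/-!
# Disproof of `EisensteinGKBound` — findings: NOT FALSE but TRIVIALLY TRUE as typed (level collapse)

Refuter work file for crux `stmt-Langlands-18272`
(`Summit.Langlands.Langlands.Theses.EisensteinGelfandKirillov.EisensteinGKBound`, THE DOOR of
route `route-Langlands-EisensteinGelfandKirillov`). Everything below is sorry-free.

## Finding (refuted-misstated in the crux-attack sense; no `¬` theorem can exist — the decl is TRUE)

The Eisenstein condition of the decl quantifies the Hecke operators `T_g` over the set
`H_v = {g : Φ g ∈ Ô ∧ nrd g ∈ ϖ_v 𝒪_v^× × ∏_{w ≠ v} 𝒪_w^×}` — NO condition on the support of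
`g`, so the `p`-component `g_p` ranges over all of `O_p^×`. Consequences, all proved here:

* `mul_mem_heckeSet` : `Ô^× · H_v ⊆ H_v` (`Φ`, `nrd` multiplicative; `nrd(Ô^×) ⊆ 𝒪̂^×`,
  `val_nrdC_eq_one_of_mem_integralUnits`).
* `conj_mem_level` : `Ô^×` normalises every level `U r = Ô^× ∩ (1 + p^r Ô)` of the decl.
* `heckeOperator_mul_left_apply` : for `γ` normalising `U`, `T_{γ g} f (x) = T_g f (x γ)`.
* `rightInvariant_of_hecke_eigen` / `rightInvariant_integralUnits` (**LEVEL COLLAPSE**): if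
  `T_g f = λ f` for all `g ∈ H_v` with `λ = c₁ v + c₂ v ≠ 0` and `H_v ≠ ∅`, then
  `f (x γ) = f x` for every `γ ∈ Ô^×` — an Eisenstein-torsion form of level `U r` in the sense
  of the decl has level `U 0 = Ô^×`, for every `r`.
* `card_le_of_rightInvariant` : a linearly independent family of `Ô^×`-invariant forms has at
  most `#(Dˣ \ D_fˣ / Ô^×)` members (finite: the tree's `finite_doubleQuotient_holds`).
* `eisensteinGKBoundNondeg_holds` : the decl VERBATIM with one hypothesis inserted
  (`∃ v ∉ S, c₁ v + c₂ v ≠ 0 ∧ H_v ≠ ∅`) is a THEOREM, with `C = #(Dˣ \ D_fˣ / Ô^×)` and no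
  dependence on `r`, using none of: `IsTotallyReal`, `5 ≤ p`, `p ∤ disc F`, total definiteness,
  splitting above `p`, `CharP k p`, the set `S`, `χ₁, χ₂`, `p`-distinguishedness.

The complementary (degenerate) corner `∀ v ∉ S, c₁ v + c₂ v = 0 ∨ H_v = ∅` is EMPTY in
mathematics (`H_v ≠ ∅` since `(a,b)_v ≅ M₂(F_v)` with maximal coordinate order at `v ∤ 2ab`;
`c₂ ≡ -c₁` off `S` would make the finite-order character `χ₂χ₁⁻¹` equal to `-1` on every
Frobenius, hence (Chebotarev) at `1`, forcing `2 = 0` in `k`, i.e. `p = 2`), but neither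
Chebotarev nor the local structure of the coordinate order is in the tree, so the decl itself is
not closed here. Either way the decl carries NO Gelfand–Kirillov content: as typed, the crux is
true for a reason unrelated to the route's mechanism, and `ProModularOfGKBound` (which takes it
as hypothesis) degenerates to unconditional pro-modularity.

## Repair (for the planner; the level-collapse witness does NOT bite it)

Restrict `g` to be supported at `v`: add to the antecedent of the Hecke condition
`∀ w ≠ v, ∀ i : Fin 4, (adelicCoords a b (↑g - 1) i) w = 0`
(then `U r g U r` is the classical `T_v`-double coset, `γ g` is supported at `v` only for
`γ_v ∈ GL₂(𝒪_v) ⊆ U r`, which acts trivially). Alternatively bound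
`dim_k S(U r, k)[𝔪_Eis]` for the Hecke algebra generated by one `T_v` per `v ∉ S`.

## Load-bearing analysis of the decl AS TYPED

None of the arithmetic hypotheses is load-bearing (see `eisensteinGKBoundNondeg_holds`); the
only load-bearing datum is `λ_v ≠ 0` for one `v` with `H_v ≠ ∅`.
-/

set_option linter.dupNamespace false

noncomputable section

open scoped Pointwise Classical
open NumberField IsDedekindDomain

namespace Summit.Langlands.Langlands.Cruxes.EisensteinGKBound.Disproof

open Literature.NumberTheory.Automorphic

universe u

variable {K : Type} [Field K] [NumberField K] {D : Type u} [Ring D] [Algebra K D]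

/-- **Hecke translation.** If `γ` normalises the level `U`, then `T_{γ g} f (x) = T_g f (x γ)`:
the `U`-orbit of `γ g U` in `D_fˣ ⧸ U` is `γ •` the `U`-orbit of `g U`. -/
theorem heckeOperator_mul_left_apply {U : Subgroup (finiteAdelicUnits K D)} {R : Type*}
    [AddCommGroup R] (S : Type*) [Semiring S] [Module S R]
    [IsHeckeTriple (⊤ : Submonoid (finiteAdelicUnits K D)) U U]
    {γ : finiteAdelicUnits K D} (hγ : ∀ u, u ∈ U ↔ γ * u * γ⁻¹ ∈ U)
    (g : finiteAdelicUnits K D) (f : QuaternionicForm D U R) (x : finiteAdelicUnits K D) :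
    QuaternionicForm.heckeOperator S (γ * g) f x =
      QuaternionicForm.heckeOperator S g f (x * γ) := by
  rw [QuaternionicForm.heckeOperator_apply, QuaternionicForm.heckeOperator_apply]
  symm
  refine finsum_mem_eq_of_bijOn (fun y => γ • y) ⟨fun y hy => ?_, fun y _ z _ h => ?_,
    fun z hz => ?_⟩ (fun y _ => ?_)
  · -- maps the orbit of `g U` into the orbit of `γ g U`
    obtain ⟨u, rfl⟩ := MulAction.mem_orbit_iff.mp hy
    refine MulAction.mem_orbit_iff.mpr ⟨⟨γ * u * γ⁻¹, (hγ u).mp u.2⟩, ?_⟩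
    show ((γ * u * γ⁻¹ : finiteAdelicUnits K D)) •
        ((γ * g : finiteAdelicUnits K D) : finiteAdelicUnits K D ⧸ U) =
      γ • ((u : finiteAdelicUnits K D) • ((g : finiteAdelicUnits K D) : finiteAdelicUnits K D ⧸ U))
    rw [MulAction.Quotient.smul_coe, MulAction.Quotient.smul_coe, MulAction.Quotient.smul_coe]
    congr 1
    simp only [smul_eq_mul]
    group
  · exact MulAction.injective γ h
  · obtain ⟨u, rfl⟩ := MulAction.mem_orbit_iff.mp hz
    have hu' : γ⁻¹ * u * γ ∈ U := by
      rw [hγ (γ⁻¹ * u * γ)]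
      simpa only [mul_assoc, mul_inv_cancel_left, mul_inv_cancel, mul_one] using u.2
    refine ⟨(⟨γ⁻¹ * u * γ, hu'⟩ : U) • (g : finiteAdelicUnits K D ⧸ U),
      MulAction.mem_orbit _ _, ?_⟩
    show γ • ((γ⁻¹ * u * γ : finiteAdelicUnits K D) •
        ((g : finiteAdelicUnits K D) : finiteAdelicUnits K D ⧸ U)) =
      ((u : finiteAdelicUnits K D)) • ((γ * g : finiteAdelicUnits K D) : finiteAdelicUnits K D ⧸ U)
    rw [MulAction.Quotient.smul_coe, MulAction.Quotient.smul_coe, MulAction.Quotient.smul_coe]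
    congr 1
    simp only [smul_eq_mul]
    group
  · -- summands agree: `(γ • y).out = γ * y.out * u` with `u ∈ U`
    obtain ⟨h', H'⟩ := QuotientGroup.mk_out_eq_mul U (γ * y.out)
    have hy : γ • y = ((γ * y.out : finiteAdelicUnits K D) : finiteAdelicUnits K D ⧸ U) := by
      conv_lhs => rw [← QuotientGroup.out_eq' y]
      rw [MulAction.Quotient.smul_coe, smul_eq_mul]
    rw [hy, H', ← mul_assoc, ← mul_assoc, f.right_invt h'.2]

/-- **Eigenvectors of a normaliser-stable family of Hecke operators are invariant.** If
`T_g f = λ • f` for every `g` in a set `H` which is stable under left multiplication by a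
subgroup `N` normalising `U`, `H` is nonempty and `λ ≠ 0`, then `f (x γ) = f x` for `γ ∈ N`. -/
theorem rightInvariant_of_hecke_eigen {U N : Subgroup (finiteAdelicUnits K D)} {k : Type*}
    [Field k] [IsHeckeTriple (⊤ : Submonoid (finiteAdelicUnits K D)) U U]
    (hN : ∀ γ ∈ N, ∀ u, u ∈ U ↔ γ * u * γ⁻¹ ∈ U) {H : Set (finiteAdelicUnits K D)}
    (hH : ∀ γ ∈ N, ∀ g ∈ H, γ * g ∈ H) {g₀ : finiteAdelicUnits K D} (hg₀ : g₀ ∈ H)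
    {c : k} (hc : c ≠ 0) (f : QuaternionicForm D U k)
    (hf : ∀ g ∈ H, QuaternionicForm.heckeOperator k g f = c • f)
    {γ : finiteAdelicUnits K D} (hγ : γ ∈ N) (x : finiteAdelicUnits K D) :
    f (x * γ) = f x := by
  have h1 := congrArg (fun φ : QuaternionicForm D U k => φ x) (hf (γ * g₀) (hH γ hγ g₀ hg₀))
  have h2 := congrArg (fun φ : QuaternionicForm D U k => φ (x * γ)) (hf g₀ hg₀)
  simp only [QuaternionicForm.coe_smul, Pi.smul_apply, smul_eq_mul] at h1 h2
  rw [heckeOperator_mul_left_apply k (hN γ hγ), h2] at h1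
  exact mul_left_cancel₀ hc h1

/-- The coercion of forms to functions, as a linear map. -/
def coeLinear (U : Subgroup (finiteAdelicUnits K D)) (k : Type*) [Semiring k] (R : Type*)
    [AddCommGroup R] [Module k R] :
    QuaternionicForm D U R →ₗ[k] (finiteAdelicUnits K D → R) where
  toFun := (⇑)
  map_add' := QuaternionicForm.coe_add
  map_smul' := QuaternionicForm.coe_smul

/-- **Dimension count.** A `k`-linearly independent family of forms (of any level `U`) all of
which are right-invariant under a subgroup `U₀` with finite double quotient `Dˣ \ D_fˣ / U₀` has
at most `#(Dˣ \ D_fˣ / U₀)` members. -/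
theorem card_le_of_rightInvariant {U U₀ : Subgroup (finiteAdelicUnits K D)} {k : Type*} [Field k]
    (hfin : Finite (MulAction.orbitRel.Quotient (inclFinite K D).range (finiteAdelicUnits K D ⧸ U₀)))
    {ι : Type*} [Fintype ι] (f : ι → QuaternionicForm D U k) (hli : LinearIndependent k f)
    (hinv : ∀ i, ∀ u ∈ U₀, ∀ x, f i (x * u) = f i x) :
    Fintype.card ι ≤
      Nat.card (MulAction.orbitRel.Quotient (inclFinite K D).range (finiteAdelicUnits K D ⧸ U₀)) := by
  classical
  set Q := MulAction.orbitRel.Quotient (inclFinite K D).range (finiteAdelicUnits K D ⧸ U₀)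
  haveI : Fintype Q := Fintype.ofFinite Q
  -- the class map and a set-theoretic section
  let cls : finiteAdelicUnits K D → Q := fun x =>
    Quotient.mk (MulAction.orbitRel (inclFinite K D).range (finiteAdelicUnits K D ⧸ U₀)) x
  let Fi : ι → Q → k := fun i q => f i (q.out).out
  have hkey : ∀ i x, Fi i (cls x) = f i x := by
    intro i x
    have hq : (cls x).out ∈ MulAction.orbit (inclFinite K D).range
        ((x : finiteAdelicUnits K D ⧸ U₀)) := by
      have := Quotient.mk_out (s := MulAction.orbitRel (inclFinite K D).range
        (finiteAdelicUnits K D ⧸ U₀)) (x : finiteAdelicUnits K D ⧸ U₀)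
      exact MulAction.orbitRel_apply.mp this
    obtain ⟨d, hd⟩ := MulAction.mem_orbit_iff.mp hq
    obtain ⟨δ, hδ⟩ := d.2
    obtain ⟨h', H'⟩ := QuotientGroup.mk_out_eq_mul U₀ ((d : finiteAdelicUnits K D) * x)
    have hd' : (cls x).out = (((d : finiteAdelicUnits K D) * x : finiteAdelicUnits K D) :
        finiteAdelicUnits K D ⧸ U₀) := by
      rw [← hd]
      change ((d : finiteAdelicUnits K D) • (x : finiteAdelicUnits K D ⧸ U₀)) = _
      rw [MulAction.Quotient.smul_coe, smul_eq_mul]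
    show f i ((cls x).out).out = f i x
    rw [hd', H', hinv i _ h'.2, ← hδ, QuaternionicForm.left_invt]
  have hcomp : ∀ i, (Fi i) ∘ cls = ⇑(f i) := fun i => funext fun x => hkey i x
  -- linear independence of the descended family
  have hli' : LinearIndependent k Fi := by
    have h1 : LinearIndependent k (fun i => ⇑(f i)) :=
      hli.map' (coeLinear U k k) (LinearMap.ker_eq_bot.mpr DFunLike.coe_injective)
    have h2 : (fun i => ⇑(f i)) = (LinearMap.funLeft k k cls) ∘ Fi := by
      funext i
      funext y
      simp only [Function.comp_apply, LinearMap.funLeft_apply, hkey]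
    rw [h2] at h1
    exact LinearIndependent.of_comp _ h1
  have := hli'.fintype_card_le_finrank
  rw [Module.finrank_fintype_fun_eq_card] at this
  simpa [Nat.card_eq_fintype_card] using this


/-! ### The data of the route decl: `U r`, the Hecke set `H_v`, the coordinate norm -/

section Specific

open Literature.NumberTheory.Automorphic.QuaternionAlgebra

variable {F : Type} [Field F] [NumberField F]

/-- `𝔸_F^∞`. -/
local notation "𝔸ᶠ" => FiniteAdeleRing (𝓞 F) F

/-- The norm form `re² - α imI² - β imJ² + αβ imK²` of `ℍ[R, α, 0, β]`. -/
def qN {R : Type*} [CommRing R] {α β : R} (q : QuaternionAlgebra R α 0 β) : R :=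
  q.re ^ 2 - α * q.imI ^ 2 - β * q.imJ ^ 2 + α * β * q.imK ^ 2

/-- The norm form is multiplicative. -/
theorem qN_mul {R : Type*} [CommRing R] {α β : R} (q q' : QuaternionAlgebra R α 0 β) :
    qN (q * q') = qN q * qN q' := by
  cases q; cases q'
  simp only [qN, QuaternionAlgebra.mk_mul_mk]
  ring

/-- The norm form of `1` is `1`. -/
theorem qN_one {R : Type*} [CommRing R] {α β : R} : qN (1 : QuaternionAlgebra R α 0 β) = 1 := by
  show (1 : R) ^ 2 - α * 0 ^ 2 - β * 0 ^ 2 + α * β * 0 ^ 2 = 1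
  ring

variable (a b : 𝓞 F)

/-- `ℍ = (a, b)_F` in Mathlib's three-parameter form, exactly as in the route decl. -/
local notation "ℍF" => QuaternionAlgebra F (algebraMap (𝓞 F) F a) (0 : F) (algebraMap (𝓞 F) F b)

/-- The coordinate reduced norm of the route decl (`nrd` there), as a function of the four
coordinates. -/
def nrdC (x : Fin 4 → 𝔸ᶠ) : 𝔸ᶠ :=
  x 0 ^ 2 - algebraMap _ _ a * x 1 ^ 2 - algebraMap _ _ b * x 2 ^ 2 +
    algebraMap _ _ a * algebraMap _ _ b * x 3 ^ 2

/-- The coordinate norm is the norm form of `Φ z`. -/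
theorem nrdC_adelicCoords (z : ScalarExtension F 𝔸ᶠ ℍF) :
    nrdC a b (adelicCoords a b z) = qN (adelicEquiv a b z) := by
  simp [nrdC, qN, adelicCoords_apply]

/-- The HECKE SET `H_v` of the route decl: integral `g` whose coordinate norm is a uniformiser at
`v` and a unit at every other place (NO condition on the support of `g`). -/
def HeckeSet (v : HeightOneSpectrum (𝓞 F)) : Set (finiteAdelicUnits F ℍF) :=
  {g | adelicEquiv a b (g : ScalarExtension F 𝔸ᶠ ℍF) ∈ adelicOrder a b ∧
    ∀ w : HeightOneSpectrum (𝓞 F), Valued.v (nrdC a b (adelicCoords a b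
      (g : ScalarExtension F 𝔸ᶠ ℍF)) w) = if w = v then WithZero.exp (-1) else 1}

/-- Integral finite adeles have valuation `≤ 1` at every place (definitional). -/
theorem val_apply_le_one_of_mem {x : 𝔸ᶠ} (hx : x ∈ integralFiniteAdeles F)
    (w : HeightOneSpectrum (𝓞 F)) : Valued.v (x w) ≤ 1 := by
  have h := (mem_integralFiniteAdeles_iff.mp hx) w
  exact (Valuation.mem_valuationSubring_iff _ _).mp h

/-- The norm form of an element of `Ô` is an integral finite adele. -/
theorem qN_mem_integralFiniteAdeles
    {q : QuaternionAlgebra 𝔸ᶠ (algebraMap (𝓞 F) 𝔸ᶠ a) (0 : 𝔸ᶠ) (algebraMap (𝓞 F) 𝔸ᶠ b)}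
    (hq : q ∈ adelicOrder a b) : qN q ∈ integralFiniteAdeles F := by
  obtain ⟨h0, h1, h2, h3⟩ := (mem_adelicOrder_iff a b).mp hq
  have ha : algebraMap (𝓞 F) 𝔸ᶠ a ∈ integralFiniteAdeles F :=
    algebraMap_integers_mem_integralFiniteAdeles F a
  have hb : algebraMap (𝓞 F) 𝔸ᶠ b ∈ integralFiniteAdeles F :=
    algebraMap_integers_mem_integralFiniteAdeles F b
  unfold qN
  exact add_mem (sub_mem (sub_mem (pow_mem h0 2) (mul_mem ha (pow_mem h1 2)))
    (mul_mem hb (pow_mem h2 2))) (mul_mem (mul_mem ha hb) (pow_mem h3 2))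

/-- **`nrd (Ô^×) ⊆ units`**: for `γ ∈ Ô^×` the coordinate norm is a unit at every place. -/
theorem val_nrdC_eq_one_of_mem_integralUnits {γ : finiteAdelicUnits F ℍF}
    (hγ : γ ∈ integralUnits a b) (w : HeightOneSpectrum (𝓞 F)) :
    Valued.v (nrdC a b (adelicCoords a b (γ : ScalarExtension F 𝔸ᶠ ℍF)) w) = 1 := by
  rw [nrdC_adelicCoords]
  obtain ⟨h1, h2⟩ := (mem_integralUnits_iff a b).mp hγ
  have hprod : qN (adelicEquiv a b (γ : ScalarExtension F 𝔸ᶠ ℍF)) *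
      qN (adelicEquiv a b ((γ⁻¹ : finiteAdelicUnits F ℍF) : ScalarExtension F 𝔸ᶠ ℍF)) = 1 := by
    rw [← qN_mul, ← map_mul, Units.mul_inv, map_one, qN_one]
  have hw : Valued.v (qN (adelicEquiv a b (γ : ScalarExtension F 𝔸ᶠ ℍF)) w) *
      Valued.v (qN (adelicEquiv a b ((γ⁻¹ : finiteAdelicUnits F ℍF) :
        ScalarExtension F 𝔸ᶠ ℍF)) w) = 1 := by
    rw [← map_mul]
    have hmul : ∀ X Y : 𝔸ᶠ, (X * Y) w = X w * Y w := fun _ _ => rfl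
    rw [← hmul, hprod]
    have hone : (1 : 𝔸ᶠ) w = 1 := rfl
    rw [hone, map_one]
  refine le_antisymm (val_apply_le_one_of_mem (qN_mem_integralFiniteAdeles a b h1) w) ?_
  calc (1 : WithZero (Multiplicative ℤ)) = _ := hw.symm
    _ ≤ Valued.v (qN (adelicEquiv a b (γ : ScalarExtension F 𝔸ᶠ ℍF)) w) * 1 :=
        mul_le_mul' le_rfl (val_apply_le_one_of_mem (qN_mem_integralFiniteAdeles a b h2) w)
    _ = _ := mul_one _

/-- **`Ô^× · H_v ⊆ H_v`**: the Hecke set of the route decl is stable under LEFT multiplication by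
the whole of `Ô^×` — in particular by units with arbitrary `p`-component. -/
theorem mul_mem_heckeSet {v : HeightOneSpectrum (𝓞 F)} {γ g : finiteAdelicUnits F ℍF}
    (hγ : γ ∈ integralUnits a b) (hg : g ∈ HeckeSet a b v) : γ * g ∈ HeckeSet a b v := by
  obtain ⟨hg1, hg2⟩ := hg
  refine ⟨?_, fun w => ?_⟩
  · rw [Units.val_mul, map_mul]
    exact Subring.mul_mem _ ((mem_integralUnits_iff a b).mp hγ).1 hg1
  · have hmul : ∀ X Y : 𝔸ᶠ, (X * Y) w = X w * Y w := fun _ _ => rfl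
    rw [← hg2 w, Units.val_mul, nrdC_adelicCoords, map_mul, qN_mul, hmul, map_mul,
      ← nrdC_adelicCoords, val_nrdC_eq_one_of_mem_integralUnits a b hγ, one_mul,
      nrdC_adelicCoords]

/-- The congruence condition of the route decl: all four coordinates of `q` lie in `c · 𝒪̂_F`. -/
def Cong (c : 𝔸ᶠ) (q : ScalarExtension F 𝔸ᶠ ℍF) : Prop :=
  ∀ i : Fin 4, ∃ y ∈ integralFiniteAdeles F, adelicCoords a b q i = c * y

/-- `Cong c q ↔ Φ q ∈ c • Ô`. -/
theorem cong_iff (c : 𝔸ᶠ) (q : ScalarExtension F 𝔸ᶠ ℍF) :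
    Cong a b c q ↔ ∃ z ∈ adelicOrder a b, adelicEquiv a b q = c • z := by
  constructor
  · intro h
    choose y hy using h
    refine ⟨⟨y 0, y 1, y 2, y 3⟩, (mem_adelicOrder_iff a b).mpr ⟨(hy 0).1, (hy 1).1, (hy 2).1,
      (hy 3).1⟩, ?_⟩
    have e0 := (hy 0).2; have e1 := (hy 1).2; have e2 := (hy 2).2; have e3 := (hy 3).2
    simp only [adelicCoords_apply, Matrix.cons_val_zero, Matrix.cons_val_one,
      Matrix.cons_val] at e0 e1 e2 e3
    ext <;> simp [e0, e1, e2, e3, smul_eq_mul]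
  · rintro ⟨z, hz, hq⟩ i
    obtain ⟨hz0, hz1, hz2, hz3⟩ := (mem_adelicOrder_iff a b).mp hz
    fin_cases i
    · exact ⟨z.re, hz0, by simp [adelicCoords_apply, hq, smul_eq_mul]⟩
    · exact ⟨z.imI, hz1, by simp [adelicCoords_apply, hq, smul_eq_mul]⟩
    · exact ⟨z.imJ, hz2, by simp [adelicCoords_apply, hq, smul_eq_mul]⟩
    · exact ⟨z.imK, hz3, by simp [adelicCoords_apply, hq, smul_eq_mul]⟩

/-- **`Ô^×` normalises every `U(r)`** (`1 + c Ô` is stable under `Ô^×`-conjugation). -/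
theorem conj_mem_level (c : 𝔸ᶠ) {W : Subgroup (finiteAdelicUnits F ℍF)}
    (hW : ∀ u, u ∈ W ↔ (u ∈ integralUnits a b ∧
      Cong a b c ((u : ScalarExtension F 𝔸ᶠ ℍF) - 1)))
    {γ u : finiteAdelicUnits F ℍF} (hγ : γ ∈ integralUnits a b) (hu : u ∈ W) :
    γ * u * γ⁻¹ ∈ W := by
  obtain ⟨hu1, hu2⟩ := (hW u).mp hu
  obtain ⟨hγ1, hγ2⟩ := (mem_integralUnits_iff a b).mp hγ
  refine (hW _).mpr ⟨Subgroup.mul_mem _ (Subgroup.mul_mem _ hγ hu1) (Subgroup.inv_mem _ hγ), ?_⟩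
  obtain ⟨z, hz, hq⟩ := (cong_iff a b c _).mp hu2
  refine (cong_iff a b c _).mpr ⟨adelicEquiv a b (γ : ScalarExtension F 𝔸ᶠ ℍF) * z *
    adelicEquiv a b ((γ⁻¹ : finiteAdelicUnits F ℍF) : ScalarExtension F 𝔸ᶠ ℍF),
    Subring.mul_mem _ (Subring.mul_mem _ hγ1 hz) hγ2, ?_⟩
  have e : ((γ * u * γ⁻¹ : finiteAdelicUnits F ℍF) : ScalarExtension F 𝔸ᶠ ℍF) - 1 =
      (γ : ScalarExtension F 𝔸ᶠ ℍF) * ((u : ScalarExtension F 𝔸ᶠ ℍF) - 1) *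
        ((γ⁻¹ : finiteAdelicUnits F ℍF) : ScalarExtension F 𝔸ᶠ ℍF) := by
    rw [mul_sub, sub_mul, mul_one, Units.mul_inv, Units.val_mul, Units.val_mul]
  rw [e, map_mul, map_mul, hq, Algebra.mul_smul_comm, Algebra.smul_mul_assoc]

/-- **LEVEL COLLAPSE.** For the level groups `U r` and the Hecke sets `H_v` of the route decl:
a form of ANY level `U r` on which the `T_g`, `g ∈ H_v`, act by a NON-ZERO scalar (and `H_v` is
inhabited) is right-invariant under the whole of `Ô^× = integralUnits a b` — i.e. it has level
`U 0`. -/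
theorem rightInvariant_integralUnits (p : ℕ) (U : ℕ → Subgroup (finiteAdelicUnits F ℍF))
    [∀ r, IsHeckeTriple (⊤ : Submonoid (finiteAdelicUnits F ℍF)) (U r) (U r)]
    (hU : ∀ r u, u ∈ U r ↔ (u ∈ integralUnits a b ∧ ∀ i : Fin 4,
      ∃ y ∈ integralFiniteAdeles F, adelicCoords a b (↑u - 1) i = ↑(p ^ r) * y))
    {k : Type*} [Field k] {v : HeightOneSpectrum (𝓞 F)} {c : k} (hc : c ≠ 0)
    {g₀ : finiteAdelicUnits F ℍF} (hg₀ : g₀ ∈ HeckeSet a b v) {r : ℕ}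
    (f : QuaternionicForm ℍF (U r) k)
    (hf : ∀ g ∈ HeckeSet a b v, QuaternionicForm.heckeOperator k g f = c • f)
    {γ : finiteAdelicUnits F ℍF} (hγ : γ ∈ integralUnits a b) (x : finiteAdelicUnits F ℍF) :
    f (x * γ) = f x := by
  refine rightInvariant_of_hecke_eigen (U := U r) (N := integralUnits a b) (fun δ hδ u => ?_)
    (fun δ hδ g hg => mul_mem_heckeSet a b hδ hg) hg₀ hc f hf hγ x
  constructor
  · exact fun hu => conj_mem_level a b (↑(p ^ r)) (hU r) hδ hu
  · intro hu
    have := conj_mem_level a b (↑(p ^ r)) (hU r) (Subgroup.inv_mem _ hδ) hu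
    simpa only [inv_inv, mul_assoc, inv_mul_cancel_left, inv_mul_cancel, mul_one] using this

end Specific

/-! ### The route decl minus its degenerate corner is a theorem with no Gelfand–Kirillov content -/

/-- `EisensteinGKBound` VERBATIM, with ONE hypothesis inserted before the conclusion: some `v ∉ S`
has `c₁ v + c₂ v ≠ 0` and an inhabited Hecke set (the non-degenerate case; its complement is
empty by Chebotarev, since `χ₂ χ₁⁻¹ ≡ -1` on all Frobenii off `S` is impossible for `p ≠ 2`,
and `H_v ≠ ∅` at every `v ∉ S`, where `(a,b)_v` splits and the coordinate order is maximal). -/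
def EisensteinGKBoundNondeg : Prop :=
  ∀ (F : Type) [Field F] [NumberField F], NumberField.IsTotallyReal F → ∀ (p : ℕ) [Fact p.Prime], 5 ≤ p → ¬ ((p : ℤ) ∣ NumberField.discr F) → ∀ (a b : (NumberField.RingOfIntegers F)), a ≠ 0 → b ≠ 0 → let D := QuaternionAlgebra F (algebraMap _ F a) (0 : F) (algebraMap _ F b); Literature.NumberTheory.Automorphic.IsTotallyDefinite F D → (∀ v : IsDedekindDomain.HeightOneSpectrum (NumberField.RingOfIntegers F), (p : (NumberField.RingOfIntegers F)) ∈ v.asIdeal → Literature.NumberTheory.Automorphic.IsSplitAt D v) → ∀ (k : Type) [Field k] [CharP k p] [TopologicalSpace k] [DiscreteTopology k] (S : Finset (IsDedekindDomain.HeightOneSpectrum (NumberField.RingOfIntegers F))), (∀ v : IsDedekindDomain.HeightOneSpectrum (NumberField.RingOfIntegers F), ((2 * p : ℕ) : (NumberField.RingOfIntegers F)) * a * b ∈ v.asIdeal → v ∈ S) → ∀ (χ₁ χ₂ : Literature.NumberTheory.GaloisRepresentations.FramedGaloisRep F k 1) (c₁ c₂ : IsDedekindDomain.HeightOneSpectrum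 (NumberField.RingOfIntegers F) → k), (∀ v ∉ S, χ₁.IsUnramifiedAt v ∧ χ₂.IsUnramifiedAt v ∧ χ₁.HasFrobCharpolyAt v (Polynomial.X - Polynomial.C (c₁ v)) ∧ χ₂.HasFrobCharpolyAt v (Polynomial.X - Polynomial.C (c₂ v))) → (∀ v : IsDedekindDomain.HeightOneSpectrum (NumberField.RingOfIntegers F), (p : (NumberField.RingOfIntegers F)) ∈ v.asIdeal → ∃ σ, χ₁.toLocal v σ ≠ χ₂.toLocal v σ) → ∀ (U : ℕ → Subgroup (Literature.NumberTheory.Automorphic.finiteAdelicUnits F D)) [∀ r, IsHeckeTriple (⊤ : Submonoid (Literature.NumberTheory.Automorphic.finiteAdelicUnits F D)) (U r) (U r)], (∀ r u, u ∈ U r ↔ (u ∈ Literature.NumberTheory.Automorphic.QuaternionAlgebra.integralUnits a b ∧ ∀ i : Fin 4, ∃ y ∈ Literature.NumberTheory.Automorphic.integralFiniteAdeles F, Literature.NumberTheory.Automorphic.QuaternionAlgebra.adelicCoords a b (↑u - 1) i = ↑(p ^ r) * y)) →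
  -- ↓↓↓ the inserted non-degeneracy hypothesis ↓↓↓
  (∃ v ∉ S, c₁ v + c₂ v ≠ 0 ∧ ∃ g : Literature.NumberTheory.Automorphic.finiteAdelicUnits F D, (let x := Literature.NumberTheory.Automorphic.QuaternionAlgebra.adelicCoords a b ↑g; Literature.NumberTheory.Automorphic.QuaternionAlgebra.adelicEquiv a b ↑g ∈ Literature.NumberTheory.Automorphic.QuaternionAlgebra.adelicOrder a b ∧ let nrd : IsDedekindDomain.FiniteAdeleRing (NumberField.RingOfIntegers F) F := x 0 ^ 2 - algebraMap _ _ a * x 1 ^ 2 - algebraMap _ _ b * x 2 ^ 2 + algebraMap _ _ a * algebraMap _ _ b * x 3 ^ 2; ∀ w : IsDedekindDomain.HeightOneSpectrum (NumberField.RingOfIntegers F), Valued.v (nrd w) = if w = v then WithZero.exp (-1) else 1)) →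
  -- ↑↑↑
  ∃ C : ℝ, ∀ (r : ℕ) (ι : Type) [Fintype ι] (f : ι → Literature.NumberTheory.Automorphic.QuaternionicForm D (U r) k), LinearIndependent k f → (∀ i, ∀ v ∉ S, ∀ g : Literature.NumberTheory.Automorphic.finiteAdelicUnits F D, (let x := Literature.NumberTheory.Automorphic.QuaternionAlgebra.adelicCoords a b ↑g; Literature.NumberTheory.Automorphic.QuaternionAlgebra.adelicEquiv a b ↑g ∈ Literature.NumberTheory.Automorphic.QuaternionAlgebra.adelicOrder a b ∧ let nrd : IsDedekindDomain.FiniteAdeleRing (NumberField.RingOfIntegers F) F := x 0 ^ 2 - algebraMap _ _ a * x 1 ^ 2 - algebraMap _ _ b * x 2 ^ 2 + algebraMap _ _ a * algebraMap _ _ b * x 3 ^ 2; ∀ w : IsDedekindDomain.HeightOneSpectrum (NumberField.RingOfIntegers F), Valued.v (nrd w) = if w = v then WithZero.exp (-1) else 1) → Literature.NumberTheory.Automorphic.QuaternionicForm.heckeOperator k g (f i) = (c₁ v + c₂ v) • f i) → (Fintype.card ι : ℝ) ≤ C * (p : ℝ) ^ (r * Module.finrank ℚ F)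

/-- **The non-degenerate case of the crux is a theorem, with `C` = the class number of `Ô` and
NO dependence on `r`**: every Eisenstein-torsion form of level `U r` in the sense of the route
decl has level `U 0 = Ô^×` (level collapse), so a linearly independent family has at most
`#(Dˣ \ D_fˣ / Ô^×)` members. None of `IsTotallyReal`, `5 ≤ p`, `p ∤ disc F`, total
definiteness, splitting above `p`, `CharP k p`, the ramification set `S`, the Galois characters
`χ₁, χ₂` or `p`-distinguishedness is used. -/
theorem eisensteinGKBoundNondeg_holds : EisensteinGKBoundNondeg := by
  intro F _ _ _hF p _ _hp _hdisc a b ha hb D _hdef _hsplit k _ _ _ _ S _hS χ₁ χ₂ c₁ c₂ _hfrob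
    _hdist U _ hU hgood
  obtain ⟨v, hvS, hc, g₀, hg₀⟩ := hgood
  have hinj := FaithfulSMul.algebraMap_injective (𝓞 F) F
  haveI : IsQuaternionAlgebra F D :=
    QuaternionAlgebra.isQuaternionAlgebra_holds ((map_ne_zero_iff _ hinj).mpr ha)
      ((map_ne_zero_iff _ hinj).mpr hb)
  have hfin := QuaternionicForm.finite_doubleQuotient_holds
    (Literature.NumberTheory.Automorphic.QuaternionAlgebra.integralUnits a b)
    (Literature.NumberTheory.Automorphic.QuaternionAlgebra.isOpen_integralUnits a b)
  refine ⟨Nat.card (MulAction.orbitRel.Quotient (inclFinite F D).range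
    (finiteAdelicUnits F D ⧸ Literature.NumberTheory.Automorphic.QuaternionAlgebra.integralUnits a b)),
    fun r ι _ f hli hH => ?_⟩
  have hinv : ∀ i, ∀ γ ∈ Literature.NumberTheory.Automorphic.QuaternionAlgebra.integralUnits a b,
      ∀ x, f i (x * γ) = f i x := fun i γ hγ x =>
    rightInvariant_integralUnits a b p U hU hc (v := v) (g₀ := g₀) hg₀ (f i)
      (fun g hg => hH i v hvS g hg) hγ x
  have hle := card_le_of_rightInvariant hfin f hli hinv
  have hp1 : (1 : ℝ) ≤ p := by exact_mod_cast (Fact.out : p.Prime).one_lt.le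
  calc (Fintype.card ι : ℝ) ≤ (Nat.card (MulAction.orbitRel.Quotient (inclFinite F D).range
        (finiteAdelicUnits F D ⧸
          Literature.NumberTheory.Automorphic.QuaternionAlgebra.integralUnits a b)) : ℝ) := by
        exact_mod_cast hle
    _ ≤ _ := le_mul_of_one_le_right (Nat.cast_nonneg _) (one_le_pow₀ hp1)

end Summit.Langlands.Langlands.Cruxes.EisensteinGKBound.Disproof
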